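import Summits.ResolutionOfSingularities.ResolutionOfSingularities.Theorems.WeightedInvariantIota3FibreDescentEngine
import Summits.ResolutionOfSingularities.ResolutionOfSingularities.Theorems.WeightedInvariantIota3SigmaAscent
import Literature.AlgebraicGeometry.Resolution.FlatLocalRegularAscent
import HarnessLib

/-!
# The generic points of the fibre of `T' ⊗_T T'` are in the class: regular local of the same dimension, flat, formally smooth, e.f.t.

Helper for `stub_keyRungGrHomLE_three` of `HypersurfaceCentreConstruction` (stmt-ResolutionOfSingularities-19897), hypothesis
(IDLexact)₃ of `keyRungGrHomLE_three_of_idealDescentExact4` (p820504); sequel of `…Iota3FibreDescentEngine` (p822040) and its localised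
form (p822119).  [OURS · descent engine, class membership; AI work, weaker than expert review.]

SETTING.  `T → T'` local rings, `𝔪T' = 𝔪'`, `C := T' ⊗_T T'` with its LEFT `T'`-algebra structure `p₁`, fibre ideal `F := p₁(𝔪')C`,
`𝔓` a minimal prime of `F` (assumed radical), `C_𝔓 := Localization.AtPrime 𝔓` with the composite algebra structure `q₁ : T' → C → C_𝔓`.
PROVED (left structure): `q₁(𝔪')C_𝔓 = 𝔪_{C_𝔓}` (`map_maximalIdeal_atPrime_eq`), `IsLocalHom q₁`, `C_𝔓` flat over `T'`
(`flat_atPrime`), Noetherian when `C` is (`T'` e.f.t. over Noetherian `T`: `isNoetherianRing_tensor`), **regular local with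
`dim C_𝔓 = dim T'` when `T'` is regular** (`isRegularLocalRing_atPrime`, `ringKrullDim_atPrime_eq` — Matsumura 23.7 (ii) with trivial
closed fibre, `Literature…IsRegularLocalRing.of_flat_of_map_maximalIdeal_eq`), formally smooth and essentially of finite type over `T'`
when `T'` is so over `T` (`formallySmooth_atPrime`, `essFiniteType_atPrime`), and the minimal primes of `F` are finitely many
(`finite_minimalPrimes_fibre`).  So the hypotheses of `FibreDescent.flagLevel_extended_of_generic_invariance` other than the INVARIANCE
itself reduce to «the fibre ideal `𝔪·(T' ⊗_T T')` is radical» (geometric reducedness of `κ(T')/κ(T)`, automatic for formally smooth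
`T → T'`; not proved here), and the invariance is to be supplied at regular local rings `C_𝔓` of dimension `dim T'` receiving `T'` by an
`𝔪`-preserving formally smooth e.f.t. local map — the same class as `T → T'`.  The RIGHT structure `q₂ = (C → C_𝔓) ∘ includeRight` is the
left structure at the flipped prime (flip `T' ⊗_T T' ≃ T' ⊗_T T'`); its class membership is not spelled out here.

References: H. Matsumura, *Commutative Ring Theory*, Thm. 23.7, Thm. 15.1; The Stacks Project, Tag 00ON (localisation is flat),
Tag 07NP/031N (formal smoothness of base change and localisation).
-/

noncomputable section

open IsLocalRing TensorProduct Algebra.TensorProduct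

set_option linter.dupNamespace false -- mandated namespace of this single-conjunct summit

namespace Summit.ResolutionOfSingularities.ResolutionOfSingularities.Cruxes.HypersurfaceCentreConstruction.LocalEngine

namespace FibreDescent

universe u

variable {T T' : Type u} [CommRing T] [CommRing T'] [Algebra T T']

/-- `T' ⊗_T T'` is Noetherian for `T'` essentially of finite type over a Noetherian `T` (it is e.f.t. over the Noetherian `T'`). [folklore] -/
theorem isNoetherianRing_tensor [IsNoetherianRing T'] [Algebra.EssFiniteType T T'] : IsNoetherianRing (T' ⊗[T] T') :=
  Algebra.EssFiniteType.isNoetherianRing T' (T' ⊗[T] T')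

/-- In a Noetherian `T' ⊗_T T'` the fibre ideal has finitely many minimal primes. [folklore] -/
theorem finite_minimalPrimes_fibre [IsLocalRing T'] [IsNoetherianRing (T' ⊗[T] T')] :
    ((maximalIdeal T').map (algebraMap T' (T' ⊗[T] T'))).minimalPrimes.Finite :=
  Ideal.finite_minimalPrimes_of_isNoetherianRing _ _

section AtPrime

variable [IsLocalRing T'] (𝔓 : Ideal (T' ⊗[T] T')) [𝔓.IsPrime]

omit [IsLocalRing T'] in
/-- `C_𝔓` is flat over `T'` (left structure) when `T'` is flat over `T`. [cite: StacksProject, Tag 00ON] -/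
theorem flat_atPrime [Module.Flat T T'] : Module.Flat T' (Localization.AtPrime 𝔓) :=
  haveI : Module.Flat (T' ⊗[T] T') (Localization.AtPrime 𝔓) := IsLocalization.flat _ 𝔓.primeCompl
  Module.Flat.trans T' (T' ⊗[T] T') (Localization.AtPrime 𝔓)

omit [IsLocalRing T'] in
/-- `C_𝔓` is essentially of finite type over `T'` when `T'` is so over `T`. [folklore] -/
theorem essFiniteType_atPrime [Algebra.EssFiniteType T T'] : Algebra.EssFiniteType T' (Localization.AtPrime 𝔓) :=
  inferInstance

omit [IsLocalRing T'] in
/-- `C_𝔓` is formally smooth over `T'` when `T'` is so over `T` (base change and localisation). [cite: StacksProject, Tag 07NP] -/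
theorem formallySmooth_atPrime [Algebra.FormallySmooth T T'] : Algebra.FormallySmooth T' (Localization.AtPrime 𝔓) :=
  haveI : Algebra.FormallySmooth (T' ⊗[T] T') (Localization.AtPrime 𝔓) :=
    Algebra.FormallySmooth.of_isLocalization 𝔓.primeCompl
  Algebra.FormallySmooth.comp T' (T' ⊗[T] T') (Localization.AtPrime 𝔓)

variable (hrad : ((maximalIdeal T').map (algebraMap T' (T' ⊗[T] T'))).IsRadical)
  (h𝔓 : 𝔓 ∈ ((maximalIdeal T').map (algebraMap T' (T' ⊗[T] T'))).minimalPrimes)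

include hrad h𝔓

/-- At a minimal prime of the radical fibre ideal: `q₁(𝔪')·C_𝔓 = 𝔪_{C_𝔓}` for the composite structure map `q₁ : T' → C_𝔓`. [folklore] -/
theorem map_maximalIdeal_atPrime_eq :
    (maximalIdeal T').map (algebraMap T' (Localization.AtPrime 𝔓)) = maximalIdeal (Localization.AtPrime 𝔓) := by
  rw [IsScalarTower.algebraMap_eq T' (T' ⊗[T] T') (Localization.AtPrime 𝔓), ← Ideal.map_map,
    ← Localization.AtPrime.map_eq_maximalIdeal]
  refine le_antisymm (Ideal.map_mono h𝔓.1.2) ?_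
  -- `𝔓·C_𝔓 ≤ rad(F·C_𝔓) = rad(F)·C_𝔓 = F·C_𝔓`
  have h1 : 𝔓.map (algebraMap (T' ⊗[T] T') (Localization.AtPrime 𝔓)) ≤
      (((maximalIdeal T').map (algebraMap T' (T' ⊗[T] T'))).map
        (algebraMap (T' ⊗[T] T') (Localization.AtPrime 𝔓))).radical := by
    rw [Ideal.radical_eq_sInf, le_sInf_iff]
    rintro Q ⟨hQF, hQprime⟩
    have hQ𝔓 : Q.comap (algebraMap (T' ⊗[T] T') (Localization.AtPrime 𝔓)) ≤ 𝔓 := by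
      calc Q.comap (algebraMap (T' ⊗[T] T') (Localization.AtPrime 𝔓))
          ≤ (maximalIdeal (Localization.AtPrime 𝔓)).comap (algebraMap (T' ⊗[T] T') (Localization.AtPrime 𝔓)) :=
            Ideal.comap_mono (IsLocalRing.le_maximalIdeal hQprime.ne_top)
        _ = 𝔓 := Localization.AtPrime.under_maximalIdeal
    have hFQ : (maximalIdeal T').map (algebraMap T' (T' ⊗[T] T')) ≤
        Q.comap (algebraMap (T' ⊗[T] T') (Localization.AtPrime 𝔓)) := by
      rw [← Ideal.map_le_iff_le_comap]
      exact hQF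
    rw [Ideal.map_le_iff_le_comap]
    exact h𝔓.2 ⟨hQprime.comap _, hFQ⟩ hQ𝔓
  rwa [← IsLocalization.map_radical 𝔓.primeCompl (Localization.AtPrime 𝔓), hrad.radical] at h1

/-- Hence `q₁ : T' → C_𝔓` is a local homomorphism. [folklore] -/
theorem isLocalHom_atPrime : IsLocalHom (algebraMap T' (Localization.AtPrime 𝔓)) :=
  Iota3.isLocalHom_of_map_maximalIdeal_eq (map_maximalIdeal_atPrime_eq 𝔓 hrad h𝔓)

/-- **The generic points of the fibre are REGULAR** (for `T'` regular, flat over `T`, `T' ⊗_T T'` Noetherian): regularity ascends along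
the flat local map `q₁ : T' → C_𝔓` with trivial closed fibre. [cite: Matsumura1987, Thm. 23.7 (ii)] -/
theorem isRegularLocalRing_atPrime (hreg : IsRegularLocalRing T') [Module.Flat T T'] [IsNoetherianRing (T' ⊗[T] T')] :
    IsRegularLocalRing (Localization.AtPrime 𝔓) := by
  haveI := isLocalHom_atPrime 𝔓 hrad h𝔓
  haveI := flat_atPrime (T := T) 𝔓
  haveI := hreg
  exact Literature.AlgebraicGeometry.Resolution.IsRegularLocalRing.of_flat_of_map_maximalIdeal_eq T'
    (Localization.AtPrime 𝔓) (map_maximalIdeal_atPrime_eq 𝔓 hrad h𝔓)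

/-- **… of the same dimension as `T'`**: `dim C_𝔓 = dim T' + dim C_𝔓/𝔪'C_𝔓 = dim T'`. [cite: Matsumura1987, Thm. 15.1] -/
theorem ringKrullDim_atPrime_eq [IsNoetherianRing T'] [Module.Flat T T'] [IsNoetherianRing (T' ⊗[T] T')] :
    ringKrullDim (Localization.AtPrime 𝔓) = ringKrullDim T' := by
  haveI := isLocalHom_atPrime 𝔓 hrad h𝔓
  haveI := flat_atPrime (T := T) 𝔓
  have h' := Ideal.height_eq_height_add_of_liesOver_of_hasGoingDown (maximalIdeal T')
    (maximalIdeal (Localization.AtPrime 𝔓))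
  rw [map_maximalIdeal_atPrime_eq 𝔓 hrad h𝔓, Ideal.map_quotient_self, Ideal.height_bot, add_zero] at h'
  rw [← IsLocalRing.maximalIdeal_height_eq_ringKrullDim, ← IsLocalRing.maximalIdeal_height_eq_ringKrullDim, h']

end AtPrime

end FibreDescent

end Summit.ResolutionOfSingularities.ResolutionOfSingularities.Cruxes.HypersurfaceCentreConstruction.LocalEngine

end
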